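import Summits.MatrixMultiplication.MatrixMultiplication.Theorems.ObstructionDescentHullDescent
import Mathlib.LinearAlgebra.Dual.Lemmas
import Mathlib.LinearAlgebra.Finsupp.LinearCombination

/- `set_option linter.dupNamespace false` as in the sibling kernel files (namespace `…Theorems.<FileStem>`). -/
set_option linter.dupNamespace false

/-!
# The design dual of the poly-degree hull: `E` as the existence of Kronecker-power designs (decomp-mm · lens 3 · gen 25)

Route `route-MatrixMultiplication-ObstructionDescent` (`ω(ℂ) = 2`); attacked leaf `E = NoPolyDegreeObstruction` (item 30889), read
through the degree-`D` hulls `Hull_D(σ_m)` of `ObstructionDescentHullCalculus` (`E ⟺ ⟨n,n,n⟩ ∈ Hull_{m^c}(σ_m)` at the cells,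
`ObstructionDescentHullDescent.noPolyDegreeObstruction_iff_hull`).  `E` as filed is a UNIVERSAL statement over an unknown ideal
(«every equation of `σ_m` of degree `≤ m^c` vanishes at `⟨n,n,n⟩`»); this module proves its exact linear-algebra DUAL, an
EXISTENTIAL statement over tensors («a signed design exists»).  Notation (informal only; the file introduces no definitions):
the POWER VECTOR of depth `D` of a tensor `x ∈ ℂ^α ⊗ ℂ^β ⊗ ℂ^γ` is the function `pv_D x : I_D → ℂ`,
`I_D := Σ_{d ≤ D} (Fin d → α) × (Fin d → β) × (Fin d → γ)`, `pv_D x ⟨d, a, b, c⟩ := x^{⊠d}(a, b, c) = ∏ᵢ x (a i) (b i) (c i)`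
(all entries of all Kronecker powers `x^{⊠d}`, `d ≤ D`; `Literature…AsymptoticSpectrum.kroneckerPow`); the DESIGN SPAN of `σ_m` at
depth `D` is `W_{m,D} := span {pv_D u | rank u ≤ m} ⊆ ℂ^{I_D}`.

* `§1` every polynomial `f` of total degree `≤ D` is a linear functional of the power vector: `f(x) = L (pv_D x)` (monomials are
  entries of Kronecker powers; built one cell at a time along the index embeddings `⟨d,(a,b,c)⟩ ↦ ⟨d+1,(a₀::a, b₀::b, c₀::c)⟩`);
  `§2` conversely every linear functional `φ` on `ℂ^{I_D}` is `aeval` of a polynomial of total degree `≤ D`.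
* `§3` DESIGN DUALITY (`§1`, `§2` and `W = W^⊥⊥`, `Subspace.forall_mem_dualAnnihilator_apply_eq_zero_iff`):
  `mem_hull_iff_powerVector_mem_span : t ∈ Hull_D(σ_m) ⟺ pv_D t ∈ W_{m,D}`, i.e. (`mem_hull_iff_exists_design`) iff finitely many
  tensors `u_j` of rank `≤ m` and weights `w_j ∈ ℂ` satisfy `t^{⊠d} = ∑ⱼ w_j · u_j^{⊠d}` for every `d ≤ D` — a SIGNED `σ_m`-DESIGN OF
  STRENGTH `D` AT `t` (point evaluation at `t` = the signed combination of point evaluations at the `u_j` on all polynomials of degree `≤ D`).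
* `§4` THE LEAF (`noPolyDegreeObstruction_iff_exists_design`):

      `E ⟺ ∀ c, ∀ τ > 2, eventually on the cells n² ≤ m, n^τ ≤ m:  ⟨n,n,n⟩^{⊠d} = ∑ⱼ w_j · u_j^{⊠d}  for all d ≤ m^c`
      for finitely many corner tensors `u_j ∈ (ℂ^{n×n})^{⊗3}` of rank `≤ m` and complex weights `w_j`.

  Proving a row `c` of `E` means EXHIBITING designs; refuting it means separating `pv_{m^c} ⟨n,n,n⟩` from the design span by a
  functional, which by `§2` is an equation (`not_exists_design_of_separating`).  For `D ≤ m` designs always exist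
  (`exists_design_of_le` = rung R1; explicitly, the Möbius design `∑_{|U| ≤ D} (∑_{j ≤ D-|U|} (-1)^j C(R-|U|, j)) δ_{∑_{i∈U} rᵢ}` over
  the sub-sums of `≤ D` terms of a rank-one expansion `t = ∑_{i ≤ R} rᵢ`); for `D > m` a design must use rank-`≤ m` tensors whose
  rank-one terms each cover several cells of `supp ⟨n,n,n⟩` (sub-sums of the standard decomposition span only monomials on `≤ m` cells).

Standard linear algebra (double annihilator); the content is the exact typing against the route's leaf.  Nothing here concerns `ω`;
sorry-free; standard axioms only.
[cite: LandsbergGCT2017, §8.3.2 (p. 226); BurgisserClausenShokrollahi1997, Prop. (15.25) (pdf p. 423); ChristandlVranaZuiddam2023, §1.1]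
-/

set_option autoImplicit false

noncomputable section

open scoped BigOperators

namespace Summit.MatrixMultiplication.MatrixMultiplication.Theorems.ObstructionDescentHullDesign

open Literature.Computability.AlgebraicComplexity (tensorRank kroneckerPow kroneckerPow_apply kroneckerPow_zero matMulTensor)
open Summit.MatrixMultiplication.MatrixMultiplication.Theorems.ObstructionDescentTorusLaws (RV mem_RV)
open Summit.MatrixMultiplication.MatrixMultiplication.Theorems.ObstructionDescentHullCalculus (hull hull_eq_univ_of_le)
open Summit.MatrixMultiplication.MatrixMultiplication.Theorems.ObstructionDescentHullDescent (noPolyDegreeObstruction_iff_hull)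
open Summit.MatrixMultiplication.MatrixMultiplication.Theses.ObstructionDescent (NoPolyDegreeObstruction)

variable {α β γ : Type}

/-! ## §1 Polynomials of degree `≤ D` are linear functionals of the power vector -/

section Functionals

/-- Peeling the first factor of a Kronecker power along prepended indices. [folklore] -/
theorem kroneckerPow_succ_vecCons (x : α → β → γ → ℂ) (p : α × β × γ) {d : ℕ} (a : Fin d → α) (b : Fin d → β)
    (c : Fin d → γ) :
    kroneckerPow x (d + 1) (Matrix.vecCons p.1 a) (Matrix.vecCons p.2.1 b) (Matrix.vecCons p.2.2 c) =
      x p.1 p.2.1 p.2.2 * kroneckerPow x d a b c := by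
  rw [kroneckerPow_apply, kroneckerPow_apply, Fin.prod_univ_succ]
  simp only [Matrix.cons_val_zero, Matrix.cons_val_succ]

/-- The constant `1` is a functional of the power vector (the depth-`0` entry `x^{⊠0}() = 1`). [bookkeeping] -/
theorem exists_dual_one (D : ℕ) :
    ∃ L : Module.Dual ℂ ((Σ d : Fin (D + 1), (Fin d → α) × (Fin d → β) × (Fin d → γ)) → ℂ),
      ∀ x : α → β → γ → ℂ, L (fun i => kroneckerPow x i.1 i.2.1 i.2.2.1 i.2.2.2) = 1 :=
  ⟨LinearMap.proj (⟨⟨0, Nat.succ_pos D⟩, Fin.elim0, Fin.elim0, Fin.elim0⟩ :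
      Σ d : Fin (D + 1), (Fin d → α) × (Fin d → β) × (Fin d → γ)),
    fun x => kroneckerPow_zero x Fin.elim0 Fin.elim0 Fin.elim0⟩

/-- Representability is monotone in the depth (restrict the functional along `I_D ↪ I_{D'}`). [bookkeeping] -/
theorem exists_dual_mono {D D' : ℕ} (h : D ≤ D') {g : (α → β → γ → ℂ) → ℂ}
    (hg : ∃ L : Module.Dual ℂ ((Σ d : Fin (D + 1), (Fin d → α) × (Fin d → β) × (Fin d → γ)) → ℂ),
      ∀ x : α → β → γ → ℂ, L (fun i => kroneckerPow x i.1 i.2.1 i.2.2.1 i.2.2.2) = g x) :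
    ∃ L : Module.Dual ℂ ((Σ d : Fin (D' + 1), (Fin d → α) × (Fin d → β) × (Fin d → γ)) → ℂ),
      ∀ x : α → β → γ → ℂ, L (fun i => kroneckerPow x i.1 i.2.1 i.2.2.1 i.2.2.2) = g x := by
  obtain ⟨L, hL⟩ := hg
  refine ⟨L ∘ₗ LinearMap.funLeft ℂ ℂ (fun i : (Σ d : Fin (D + 1), (Fin d → α) × (Fin d → β) × (Fin d → γ)) =>
    (⟨Fin.castLE (Nat.succ_le_succ h) i.1, i.2⟩ : Σ d : Fin (D' + 1), (Fin d → α) × (Fin d → β) × (Fin d → γ))), fun x => ?_⟩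
  rw [LinearMap.comp_apply, ← hL x]
  rfl

/-- Multiplying a representable function by a coordinate `x_p` keeps it representable, one level deeper (pull back along
`⟨d, (a,b,c)⟩ ↦ ⟨d+1, (a₀::a, b₀::b, c₀::c)⟩`). [bookkeeping] -/
theorem exists_dual_coord_mul {D : ℕ} (p : α × β × γ) {g : (α → β → γ → ℂ) → ℂ}
    (hg : ∃ L : Module.Dual ℂ ((Σ d : Fin (D + 1), (Fin d → α) × (Fin d → β) × (Fin d → γ)) → ℂ),
      ∀ x : α → β → γ → ℂ, L (fun i => kroneckerPow x i.1 i.2.1 i.2.2.1 i.2.2.2) = g x) :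
    ∃ L : Module.Dual ℂ ((Σ d : Fin (D + 1 + 1), (Fin d → α) × (Fin d → β) × (Fin d → γ)) → ℂ),
      ∀ x : α → β → γ → ℂ, L (fun i => kroneckerPow x i.1 i.2.1 i.2.2.1 i.2.2.2) = x p.1 p.2.1 p.2.2 * g x := by
  obtain ⟨L, hL⟩ := hg
  refine ⟨L ∘ₗ LinearMap.funLeft ℂ ℂ (fun i : (Σ d : Fin (D + 1), (Fin d → α) × (Fin d → β) × (Fin d → γ)) =>
    (⟨i.1.succ, Matrix.vecCons p.1 i.2.1, Matrix.vecCons p.2.1 i.2.2.1, Matrix.vecCons p.2.2 i.2.2.2⟩ :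
      Σ d : Fin (D + 1 + 1), (Fin d → α) × (Fin d → β) × (Fin d → γ))), fun x => ?_⟩
  have key : LinearMap.funLeft ℂ ℂ (fun i : (Σ d : Fin (D + 1), (Fin d → α) × (Fin d → β) × (Fin d → γ)) =>
      (⟨i.1.succ, Matrix.vecCons p.1 i.2.1, Matrix.vecCons p.2.1 i.2.2.1, Matrix.vecCons p.2.2 i.2.2.2⟩ :
        Σ d : Fin (D + 1 + 1), (Fin d → α) × (Fin d → β) × (Fin d → γ)))
      (fun i => kroneckerPow x i.1 i.2.1 i.2.2.1 i.2.2.2) =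
      x p.1 p.2.1 p.2.2 • fun i : (Σ d : Fin (D + 1), (Fin d → α) × (Fin d → β) × (Fin d → γ)) =>
        kroneckerPow x i.1 i.2.1 i.2.2.1 i.2.2.2 := by
    funext i
    show kroneckerPow x (i.1 + 1) (Matrix.vecCons p.1 i.2.1) (Matrix.vecCons p.2.1 i.2.2.1) (Matrix.vecCons p.2.2 i.2.2.2) =
      x p.1 p.2.1 p.2.2 * kroneckerPow x i.1 i.2.1 i.2.2.1 i.2.2.2
    exact kroneckerPow_succ_vecCons x p _ _ _
  rw [LinearMap.comp_apply, key, map_smul, hL, smul_eq_mul]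

/-- Multiplying by a power of a coordinate. [bookkeeping] -/
theorem exists_dual_pow_mul {D : ℕ} (p : α × β × γ) (k : ℕ) {g : (α → β → γ → ℂ) → ℂ}
    (hg : ∃ L : Module.Dual ℂ ((Σ d : Fin (D + 1), (Fin d → α) × (Fin d → β) × (Fin d → γ)) → ℂ),
      ∀ x : α → β → γ → ℂ, L (fun i => kroneckerPow x i.1 i.2.1 i.2.2.1 i.2.2.2) = g x) :
    ∃ L : Module.Dual ℂ ((Σ d : Fin (D + k + 1), (Fin d → α) × (Fin d → β) × (Fin d → γ)) → ℂ),
      ∀ x : α → β → γ → ℂ, L (fun i => kroneckerPow x i.1 i.2.1 i.2.2.1 i.2.2.2) = x p.1 p.2.1 p.2.2 ^ k * g x := by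
  induction k with
  | zero => simpa only [pow_zero, one_mul] using hg
  | succ k ih =>
    rw [← Nat.add_assoc]
    simpa only [pow_succ', mul_assoc] using exists_dual_coord_mul p ih

/-- Multiplying by a monomial supported on a finite set of cells. [bookkeeping] -/
theorem exists_dual_prod_pow_mul [DecidableEq α] [DecidableEq β] [DecidableEq γ] {D : ℕ} (e : α × β × γ → ℕ)
    (s : Finset (α × β × γ)) {g : (α → β → γ → ℂ) → ℂ}
    (hg : ∃ L : Module.Dual ℂ ((Σ d : Fin (D + 1), (Fin d → α) × (Fin d → β) × (Fin d → γ)) → ℂ),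
      ∀ x : α → β → γ → ℂ, L (fun i => kroneckerPow x i.1 i.2.1 i.2.2.1 i.2.2.2) = g x) :
    ∀ N : ℕ, N = D + ∑ p ∈ s, e p →
      ∃ L : Module.Dual ℂ ((Σ d : Fin (N + 1), (Fin d → α) × (Fin d → β) × (Fin d → γ)) → ℂ),
        ∀ x : α → β → γ → ℂ, L (fun i => kroneckerPow x i.1 i.2.1 i.2.2.1 i.2.2.2) =
          (∏ p ∈ s, x p.1 p.2.1 p.2.2 ^ e p) * g x := by
  induction s using Finset.induction_on with
  | empty =>
    rintro N rfl
    simpa only [Finset.prod_empty, one_mul, Finset.sum_empty] using hg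
  | insert p s hp ih =>
    rintro N rfl
    have h := exists_dual_pow_mul p (e p) (ih _ rfl)
    rw [Finset.sum_insert hp, Nat.add_comm (e p), ← Nat.add_assoc]
    simpa only [Finset.prod_insert hp, mul_assoc] using h

/-- **Polynomials of degree `≤ D` are linear functionals of the depth-`D` power vector**: for `totalDegree f ≤ D` there is a
linear `L` with `f(x) = L (pv_D x)` for every tensor `x`. [bookkeeping] -/
theorem exists_dual_aeval [Fintype α] [Fintype β] [Fintype γ] {D : ℕ} (f : MvPolynomial (α × β × γ) ℂ)
    (hf : f.totalDegree ≤ D) :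
    ∃ L : Module.Dual ℂ ((Σ d : Fin (D + 1), (Fin d → α) × (Fin d → β) × (Fin d → γ)) → ℂ),
      ∀ x : α → β → γ → ℂ, L (fun i => kroneckerPow x i.1 i.2.1 i.2.2.1 i.2.2.2) =
        MvPolynomial.aeval (fun p : α × β × γ => x p.1 p.2.1 p.2.2) f := by
  classical
  have hmono : ∀ d : ↥f.support,
      ∃ L : Module.Dual ℂ ((Σ d : Fin (D + 1), (Fin d → α) × (Fin d → β) × (Fin d → γ)) → ℂ),
        ∀ x : α → β → γ → ℂ, L (fun i => kroneckerPow x i.1 i.2.1 i.2.2.1 i.2.2.2) =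
          ∏ p, x p.1 p.2.1 p.2.2 ^ (d : (α × β × γ) →₀ ℕ) p := by
    intro d
    have hdeg : ∑ p, (d : (α × β × γ) →₀ ℕ) p ≤ D := by
      have h1 := MvPolynomial.le_totalDegree d.2
      rw [Finsupp.sum_fintype _ _ (fun _ => rfl)] at h1
      exact h1.trans hf
    have h := exists_dual_prod_pow_mul (fun p => (d : (α × β × γ) →₀ ℕ) p) Finset.univ
      (exists_dual_one (α := α) (β := β) (γ := γ) 0) _ (Nat.zero_add _).symm
    simp only [mul_one] at h
    exact exists_dual_mono hdeg h
  choose L hL using hmono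
  refine ⟨∑ d : ↥f.support, f.coeff d • L d, fun x => ?_⟩
  rw [MvPolynomial.aeval_eq_eval, MvPolynomial.eval_eq', ← Finset.sum_coe_sort f.support, LinearMap.sum_apply]
  exact Finset.sum_congr rfl fun d _ => by rw [LinearMap.smul_apply, hL, smul_eq_mul]

end Functionals

/-! ## §2 Linear functionals of the power vector are polynomials of degree `≤ D` -/

section Polynomials

variable [Fintype α] [Fintype β] [Fintype γ]

/-- **Every functional is a polynomial**: for a linear functional `φ` on `ℂ^{I_D}` the polynomial
`∑_{i = ⟨d,(a,b,c)⟩} φ(e_i) · ∏_{s<d} X_{(a s, b s, c s)}` has total degree `≤ D` and evaluates to `φ (pv_D x)` at every `x`. [bookkeeping] -/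
theorem exists_poly_of_dual {D : ℕ}
    (φ : Module.Dual ℂ ((Σ d : Fin (D + 1), (Fin d → α) × (Fin d → β) × (Fin d → γ)) → ℂ)) :
    ∃ f : MvPolynomial (α × β × γ) ℂ, f.totalDegree ≤ D ∧
      ∀ x : α → β → γ → ℂ, MvPolynomial.aeval (fun p : α × β × γ => x p.1 p.2.1 p.2.2) f =
        φ (fun i => kroneckerPow x i.1 i.2.1 i.2.2.1 i.2.2.2) := by
  classical
  refine ⟨∑ i : (Σ d : Fin (D + 1), (Fin d → α) × (Fin d → β) × (Fin d → γ)),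
    MvPolynomial.C (φ (fun j => if i = j then 1 else 0)) * ∏ s : Fin i.1, MvPolynomial.X (i.2.1 s, i.2.2.1 s, i.2.2.2 s),
    ?_, fun x => ?_⟩
  · refine (MvPolynomial.totalDegree_finsetSum _ _).trans (Finset.sup_le fun i _ => ?_)
    refine (MvPolynomial.totalDegree_mul _ _).trans ?_
    rw [MvPolynomial.totalDegree_C, zero_add]
    refine (MvPolynomial.totalDegree_finsetProd _ _).trans ?_
    calc ∑ s : Fin i.1, (MvPolynomial.X (i.2.1 s, i.2.2.1 s, i.2.2.2 s) : MvPolynomial (α × β × γ) ℂ).totalDegree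
        = ∑ _s : Fin i.1, 1 := Finset.sum_congr rfl fun s _ => MvPolynomial.totalDegree_X (R := ℂ) _
      _ = i.1 := by simp
      _ ≤ D := Nat.lt_succ_iff.1 i.1.2
  · conv_rhs => rw [pi_eq_sum_univ (fun i : (Σ d : Fin (D + 1), (Fin d → α) × (Fin d → β) × (Fin d → γ)) =>
      kroneckerPow x i.1 i.2.1 i.2.2.1 i.2.2.2)]
    simp only [map_sum, map_smul, map_mul, MvPolynomial.aeval_C, map_prod, MvPolynomial.aeval_X, smul_eq_mul,
      kroneckerPow_apply, Algebra.algebraMap_self_apply]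
    exact Finset.sum_congr rfl fun i _ => mul_comm _ _

end Polynomials

/-! ## §3 The duality: hull membership = power vector in the design span -/

section Duality

variable [Fintype α] [Fintype β] [Fintype γ]

/-- **Design duality.**  `t ∈ Hull_D(σ_m)` iff its depth-`D` power vector `pv_D t = (t^{⊠d}(a,b,c))_{d ≤ D, (a,b,c)}` lies in the span
of the power vectors of the tensors of rank `≤ m`.  (`⟹`: a functional vanishing on the design span is, by `§2`, an equation of `σ_m`
of degree `≤ D`, so it vanishes at `t`; conclude by `W = W^⊥⊥`.  `⟸`: an equation of degree `≤ D` is, by `§1`, a functional of the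
power vector vanishing on the generators of the design span.) [cite: LandsbergGCT2017, §8.3.2 (p. 226)] -/
theorem mem_hull_iff_powerVector_mem_span {m D : ℕ} (t : α → β → γ → ℂ) :
    t ∈ hull α β γ m D ↔
      (fun i : (Σ d : Fin (D + 1), (Fin d → α) × (Fin d → β) × (Fin d → γ)) => kroneckerPow t i.1 i.2.1 i.2.2.1 i.2.2.2) ∈
        Submodule.span ℂ ((fun u : α → β → γ → ℂ =>
          fun i : (Σ d : Fin (D + 1), (Fin d → α) × (Fin d → β) × (Fin d → γ)) => kroneckerPow u i.1 i.2.1 i.2.2.1 i.2.2.2) ''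
            {u : α → β → γ → ℂ | tensorRank u ≤ m}) := by
  classical
  constructor
  · intro ht
    rw [← Subspace.forall_mem_dualAnnihilator_apply_eq_zero_iff]
    intro φ hφ
    obtain ⟨f, hdeg, hf⟩ := exists_poly_of_dual φ
    have hRV : f ∈ RV α β γ m := mem_RV.2 fun u hu => by
      rw [hf]
      exact (Submodule.mem_dualAnnihilator φ).1 hφ _ (Submodule.subset_span ⟨u, hu, rfl⟩)
    rw [← hf]
    exact ht f hdeg hRV
  · intro hW f hdeg hf
    obtain ⟨L, hL⟩ := exists_dual_aeval f hdeg
    rw [← hL]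
    refine LinearMap.mem_ker.1 (Submodule.span_le.2 ?_ hW)
    rintro _ ⟨u, hu, rfl⟩
    rw [SetLike.mem_coe, LinearMap.mem_ker, hL]
    exact mem_RV.1 hf u hu

/-- **Design form.**  `t ∈ Hull_D(σ_m)` iff there is a SIGNED `σ_m`-DESIGN OF STRENGTH `D` AT `t`: finitely many tensors `u ∈ S` of
rank `≤ m` and weights `w` with `t^{⊠d} = ∑_{u ∈ S} w_u · u^{⊠d}` for every `d ≤ D`. [cite: LandsbergGCT2017, §8.3.2 (p. 226)] -/
theorem mem_hull_iff_exists_design {m D : ℕ} (t : α → β → γ → ℂ) :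
    t ∈ hull α β γ m D ↔ ∃ S : Finset (α → β → γ → ℂ), (∀ u ∈ S, tensorRank u ≤ m) ∧
      ∃ w : ↥S → ℂ, ∀ d : ℕ, d ≤ D →
        kroneckerPow t d = ∑ u : ↥S, w u • kroneckerPow (u : α → β → γ → ℂ) d := by
  rw [mem_hull_iff_powerVector_mem_span, Submodule.mem_span_image_iff_exists_fun]
  constructor
  · rintro ⟨S, hS, w, hw⟩
    refine ⟨S, fun u hu => hS hu, w, fun d hd => funext fun a => funext fun b => funext fun c => ?_⟩
    have h := congr_fun hw ⟨⟨d, Nat.lt_succ_of_le hd⟩, a, b, c⟩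
    rw [Finset.sum_apply] at h
    rw [← h, Finset.sum_apply, Finset.sum_apply, Finset.sum_apply]
    rfl
  · rintro ⟨S, hS, w, hw⟩
    refine ⟨S, fun u hu => hS u hu, w, funext fun i => ?_⟩
    rw [Finset.sum_apply, hw i.1 (Nat.le_of_lt_succ i.1.2), Finset.sum_apply, Finset.sum_apply, Finset.sum_apply]
    rfl

/-- Rung R1 in design form: for `D ≤ m` every tensor admits a `σ_m`-design of strength `D` (there are no equations of `σ_m` of
degree `≤ m`).  On paper the explicit design is the Möbius one over the sub-sums of `≤ D` terms of any rank-one expansion.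
[cite: LandsbergGCT2017, Prop. 8.3.4.2 (p. 227)] -/
theorem exists_design_of_le {m D : ℕ} (h : D ≤ m) (t : α → β → γ → ℂ) :
    ∃ S : Finset (α → β → γ → ℂ), (∀ u ∈ S, tensorRank u ≤ m) ∧
      ∃ w : ↥S → ℂ, ∀ d : ℕ, d ≤ D → kroneckerPow t d = ∑ u : ↥S, w u • kroneckerPow (u : α → β → γ → ℂ) d :=
  (mem_hull_iff_exists_design t).1 (by rw [hull_eq_univ_of_le h]; exact Set.mem_univ t)

/-- An equation SEPARATES: if some `f ∈ RV(σ_m)` of degree `≤ D` does not vanish at `t`, there is no `σ_m`-design of strength `D`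
at `t` (the contrapositive reading used by refuters of `E`). [bookkeeping] -/
theorem not_exists_design_of_separating {m D : ℕ} {t : α → β → γ → ℂ} {f : MvPolynomial (α × β × γ) ℂ}
    (hdeg : f.totalDegree ≤ D) (hf : f ∈ RV α β γ m)
    (hne : MvPolynomial.aeval (fun p : α × β × γ => t p.1 p.2.1 p.2.2) f ≠ 0) :
    ¬ ∃ S : Finset (α → β → γ → ℂ), (∀ u ∈ S, tensorRank u ≤ m) ∧
      ∃ w : ↥S → ℂ, ∀ d : ℕ, d ≤ D → kroneckerPow t d = ∑ u : ↥S, w u • kroneckerPow (u : α → β → γ → ℂ) d :=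
  fun h => hne ((mem_hull_iff_exists_design t).2 h f hdeg hf)

end Duality

/-! ## §4 The leaf `E` as the existence of Kronecker-power designs for `⟨n,n,n⟩` -/

section Leaf

/-- **`E` as the existence of designs**: `E ⟺` for every `c` and `τ > 2`, eventually on the cells `n² ≤ m`, `n^τ ≤ m`, there are
finitely many corner tensors `u ∈ (ℂ^{n×n})^{⊗3}` of rank `≤ m` and complex weights `w_u` with `⟨n,n,n⟩^{⊠d} = ∑_u w_u · u^{⊠d}` for
ALL `d ≤ m^c` — a signed `σ_m`-design of strength `m^c` at matrix multiplication.  Proving row `c` of `E` = exhibiting such designs;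
a violation of `E` = a linear functional separating the power vector of `⟨n,n,n⟩` from those of `σ_m`.
[route E = NoPolyDegreeObstruction, dual form] -/
theorem noPolyDegreeObstruction_iff_exists_design : NoPolyDegreeObstruction ↔
    ∀ c : ℕ, ∀ τ : ℝ, 2 < τ → ∃ n₀ : ℕ, ∀ n m : ℕ, n₀ ≤ n → n * n ≤ m → (n : ℝ) ^ τ ≤ (m : ℝ) →
      ∃ S : Finset (Fin n × Fin n → Fin n × Fin n → Fin n × Fin n → ℂ), (∀ u ∈ S, tensorRank u ≤ m) ∧
        ∃ w : ↥S → ℂ, ∀ d : ℕ, d ≤ m ^ c →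
          kroneckerPow (fun a b c => matMulTensor ℂ n n n a b c) d =
            ∑ u : ↥S, w u • kroneckerPow (u : Fin n × Fin n → Fin n × Fin n → Fin n × Fin n → ℂ) d := by
  rw [noPolyDegreeObstruction_iff_hull]
  refine forall_congr' fun c => forall_congr' fun τ => forall_congr' fun _ => exists_congr fun n₀ =>
    forall_congr' fun n => forall_congr' fun m => forall_congr' fun _ => forall_congr' fun _ =>
      forall_congr' fun _ => ?_
  exact mem_hull_iff_exists_design _

/-- **`E` in design-span form**: `E ⟺` at the cells the power vector `pv_{m^c} ⟨n,n,n⟩` (all entries of all Kronecker powers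
`⟨n,n,n⟩^{⊠d}`, `d ≤ m^c`) lies in the linear span of the power vectors of the corner tensors of rank `≤ m`.
[route E = NoPolyDegreeObstruction, dual form] -/
theorem noPolyDegreeObstruction_iff_powerVector_mem_span : NoPolyDegreeObstruction ↔
    ∀ c : ℕ, ∀ τ : ℝ, 2 < τ → ∃ n₀ : ℕ, ∀ n m : ℕ, n₀ ≤ n → n * n ≤ m → (n : ℝ) ^ τ ≤ (m : ℝ) →
      (fun i : (Σ d : Fin (m ^ c + 1), (Fin d → Fin n × Fin n) × (Fin d → Fin n × Fin n) × (Fin d → Fin n × Fin n)) =>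
          kroneckerPow (fun a b c => matMulTensor ℂ n n n a b c) i.1 i.2.1 i.2.2.1 i.2.2.2) ∈
        Submodule.span ℂ ((fun u : Fin n × Fin n → Fin n × Fin n → Fin n × Fin n → ℂ =>
          fun i : (Σ d : Fin (m ^ c + 1), (Fin d → Fin n × Fin n) × (Fin d → Fin n × Fin n) × (Fin d → Fin n × Fin n)) =>
            kroneckerPow u i.1 i.2.1 i.2.2.1 i.2.2.2) ''
          {u : Fin n × Fin n → Fin n × Fin n → Fin n × Fin n → ℂ | tensorRank u ≤ m}) := by
  rw [noPolyDegreeObstruction_iff_hull]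
  refine forall_congr' fun c => forall_congr' fun τ => forall_congr' fun _ => exists_congr fun n₀ =>
    forall_congr' fun n => forall_congr' fun m => forall_congr' fun _ => forall_congr' fun _ =>
      forall_congr' fun _ => ?_
  exact mem_hull_iff_powerVector_mem_span _

end Leaf

end Summit.MatrixMultiplication.MatrixMultiplication.Theorems.ObstructionDescentHullDesign

end
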